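import Summits.Langlands.Langlands.Theses.PhantomRMYoshida
import Literature.NumberTheory.Automorphic.SerreConjectureProofs
import Literature.NumberTheory.GaloisRepresentations.SerreWeightLowerBoundProofs
import Literature.NumberTheory.Automorphic.NewformAdelisationHeckeOperator
import Literature.NumberTheory.Automorphic.CuspidalRepDataOfCuspForm
import Literature.NumberTheory.Automorphic.NewformAdelisationArchCovariance

/-!
# Line `adelic-newform-datum-double-twist` — skeleton for crux `PhantomRMYoshida.SerreKWAutomorphicGL2`
# (stmt-Langlands-12944, route-Langlands-PhantomRMYoshida; crux-plan round 1, RESHAPED by the line lead 2026-08-16)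

**Idea** (crux-idea card `adelic-newform-datum-double-twist`, ideator 1; triage r1: pass ×3,
merge ≈ `cyclic-bj-datum-adelic-newform` ≈ `lowest-weight-casimir-dictionary` K1+K2 on the
automorphic half).  The crux is Serre's conjecture for `GL₂/ℚ` read in the summit's automorphic
L-normalisation.  Its content splits as

* (A) GALOIS SIDE = Khare–Wintenberger (in the tree: the named fact `khare_wintenberger p k`,
  strong form, `∃ ι_f : 𝓞_f →+* k` INSIDE) + ALIGNMENT of KW's hidden residual coefficient map
  `ι_f` with the crux's prescribed pair `(ι : ℚ̄_p ≃ ℂ, red : 𝒪_{ℚ̄_p} → k)` — a residue-adapted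
  embedding `θ : 𝓞_f → 𝒪_{ℚ̄_p}` with `red ∘ θ = ι_f` (pure algebraic number theory) and the
  Galois-CONJUGATE newform `f^τ`, `τ = ι ∘ θ` (Diamond–Shurman Thm. 6.5.4);
* (B) AUTOMORPHIC SIDE = the LEVER of the card: the Borel–Jacquet datum GENERATED by the adelic
  lift `φ_g = adelicLiftFunA M w g` of the (conjugate) newform `g`
  (`CuspidalAutomorphicRepData.ofCuspForm`), whose unramified Hecke eigenvalues are PROVED in the
  tree (`heckeOperator_principalCongruenceLevel_adelicLiftFunA_one/two`: unitary Satake pair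
  `{α, β}`, `(√q)^{w-1}(α + β) = a_q`, `αβ = ε(q)`) and whose Harish-Chandra parameter is
  `{(w-1)/2, (1-w)/2}` (lowest-weight vector, `GL2CasimirParameter`), normalised by the DOUBLE
  TWIST `π ⊗ (ofDirichlet ε)⁻¹∘det ⊗ |det|^{(w-1)/2}`: the finite-order twist INVERTS the Satake
  pair (`{α, β}·ε(q)⁻¹ = {β⁻¹, α⁻¹}`, no contragredient, no Ramanujan), the norm twist makes the
  infinity type `{(w-1, 0), (0, w-1)}` — L-algebraic for EVERY `w` — and the Satake multiset the
  INVERTED ROOTS of the Hecke polynomial `H = X² - a_q X + ε(q) q^{w-1}`, so that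
  `arithFrobPolyOfSatake ι q 1 (H.roots.map (·⁻¹)) = H.map ι⁻¹` TERMWISE
  (`arithFrobPolyOfSatake_one_rootsInv`, proved below) — literally the polynomial that
  `IsGaloisRepOfNewform1Int` (the conclusion of `khare_wintenberger`) reduces to `charpoly σ̄(Frob_q)`.

**Shape.** `SerreKWAutomorphicGL2_of : SerreKWAutomorphicGL2` (no hypotheses) is proved at the
end of this file from seven `stub_*` theorems (one of them the named fact, six proof obligations) by
REAL glue (integrality transport of the KW polynomial along `θ`, polynomial-map bookkeeping, the
root-form identity, and the three cofinite exceptional sets `q ∣ Np`, `q ∣ NM`, the twist's bad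
places); `sorry` occurs only inside the stubs; stub statements mention only Mathlib and
`Literature.*` declarations (no local definition), so each can land as
`Theorems/SerreKWAutomorphicGL2<Stub>.lean` with `--supports stmt-Langlands-12944`.

* `stub_khareWintenberger` — THE NAMED-FACT INPUT (not a proof obligation): the tree's named fact
  `khare_wintenberger p k` (Serre's conjecture, strong form, KW-I Thm. 1.2 + 9.1 with Kisin 2009)
  for all `p, k`, VERBATIM.  It is consumed only through the sorry-free re-indexing
  `serreModularityTwoLe_of_khareWintenberger` (weak form with Serre's bound `2 ≤ k(σ̄)`:
  `nonempty_localRestrictionAt`, `nonempty_ringHom_residue`, `two_le_serreWeightLocal_holds`).  It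
  is registered as a stub only because the skeleton audit admits no named-fact hypothesis on
  `<Crux>_of`; the lead closes the line by deleting it and taking
  `(hKW : ∀ p …, khare_wintenberger p k)` as the ONE hypothesis of the final theorem
  (`proof.conditional` on KW — the minimum possible, triage r1-2/3).  Trust base = {KW}: no new
  Literature fact (triage: drop the card's stub A1 `serre_wrt_embedding`).
* `stub_residueAdaptedEmbedding` (M; pure algebra, provable now) — lever (A): every `j : 𝓞_f → k`
  is `red ∘ θ` for an embedding `θ : 𝓞_f → 𝒪_{ℚ̄_p}` of the shape `ι⁻¹ ∘ τ`, `τ : K_f → ℂ`.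
* `stub_conjugateNewform` (M–L; classical, provable now) — Galois-conjugate eigenpackets of
  newforms are newform eigenpackets (DS Thm. 6.5.4 via the PROVED `Γ₁` integral lattice).
* `stub_loweringKillsLift` (M; classical analysis) — `φ_f` is smooth in the archimedean variable
  and killed by the lowering operator along `ι_𝔸` (Cauchy–Riemann read in the group).  RESHAPE by
  the lead (2026-08-16): verbatim the sibling line `lowest-weight-casimir-dictionary`'s registered
  stub 1, made an explicit input so that the Cauchy–Riemann / Casimir computation is done ONCE.
* `stub_adelicLiftIsCuspForm` (L; classical analysis) — from Stub 4's two conclusions,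
  `φ_f ∈ 𝒜₀(GL₂)`: Borel–Jacquet 4.2 conditions for the defined lift + the cusp condition at
  function level (`Z(𝔤)`-finiteness via the landed `Rat.isZFinite_of_casimir_of_zed`).
* `stub_archParameterOfGeneratedDatum` (L; the dictionary proper, archimedean half; HARDEST, held
  by the lead) — from `X φ_f = 0` and `φ_f ∈ 𝒜₀`: the datum generated by `φ_f` has Harish-Chandra
  parameter `{(w-1)/2, (1-w)/2}` (infinitesimal character by minimality of the stable closure).
* `stub_dictionaryL` (M/L; the dictionary proper, finite half + THE DOUBLE TWIST, assembly over the
  proved Hecke-operator and twist API) — RESHAPE: the former `stub_unitarySatakeOfGeneratedDatum` and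
  `stub_doubleTwist` merged into the sibling line's registered `stub_dictionaryL` (abstract cuspidal
  `π` with `φ_f ∈ W ∖ W'` and the archimedean parameter ⟹ an L-algebraic `π₂` with Satake
  multiset `H_v.roots⁻¹` a.e.), to keep the registered stub count at 7.

**Disproof used** (`Cruxes/SerreKWAutomorphicGL2/Disproof.lean`, cdisprove cycle 1, rc 0, read in
full; it is a workfile, not importable): it contains NO `_false_without_<H>` theorem and no
`-- Targets`, so there is no obstruction of that form to honour and no landed `Negative/` lemma to
import (none exists; `ledger negatives --problem Langlands` = 1 unrelated entry, K3 Kuga–Satake).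
What the stub set honours instead: §2 load-bearing analysis — `IsOdd` and `IsIrreducible` are
consumed EXACTLY ONCE, at the KW step (`stub_khareWintenberger` through
`serreModularityTwoLe_of_khareWintenberger`), never on the automorphic side; §3 `red_factors_through_residue` is the first step of `stub_residueAdaptedEmbedding`'s proof
(kernel of `red` = `𝔪`); `hcpt₂_inhabited` / `iota_inhabited` = non-vacuity of the quantifiers the
glue passes through; §4's convention-flip list (arithmetic Frobenius, sign of the half-twist,
nebentypus, `ι` vs residual embedding) is exactly what `stub_doubleTwist` + `stub_residueAdaptedEmbedding`
pin down, kernel-checked here by `arithFrobPolyOfSatake_one_rootsInv` and the glue.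
-/

noncomputable section

open scoped MatrixGroups Classical Polynomial
open NumberField IsDedekindDomain Filter Polynomial CongruenceSubgroup
open Literature.NumberTheory.Automorphic Literature.NumberTheory.EllipticCurves.ModularForms
  Literature.NumberTheory.GaloisRepresentations
  Literature.NumberTheory.GaloisRepresentations.ModPGaloisRep
  Literature.NumberTheory.GaloisRepresentations.IsNonarchimedeanLocalField

namespace Summit.Langlands.Langlands.Cruxes.SerreKWAutomorphicGL2.AdelicNewformDatumDoubleTwist

set_option linter.dupNamespace false
set_option linter.unusedVariables false

/-! ## Stub 1 — the NAMED-FACT INPUT: the tree's `khare_wintenberger`, verbatim -/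

/-- **Stub 1 (NAMED-FACT INPUT, not a proof obligation): Serre's modularity conjecture, strong form
(Khare–Wintenberger (I) Thm. 1.2 + Thm. 9.1, Hypothesis (H) = Kisin 2009), EXACTLY as vendored in
the tree** — the named fact `Literature.NumberTheory.Automorphic.khare_wintenberger p k`
(`= SerreModularityConjecture p k`: every continuous, irreducible, odd `σ̄ : Γ_ℚ → GL₂(k)`, `k`
algebraically closed of characteristic `p`, arises along some `ι_f : 𝓞_f →+* k` from a newform of
level `N(σ̄)` and weight `k(σ̄)`, `IsGaloisRepOfNewform1Int` away from `N(σ̄) p`), for all `p` and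
`k`.  It is the ONE unproved input of the line and is consumed only through the sorry-free
re-indexing `serreModularityTwoLe_of_khareWintenberger` below (weak form with Serre's bound
`2 ≤ k(σ̄)`).  It is registered as a stub only because the skeleton audit admits no named-fact
hypothesis on `<Crux>_of`; NOBODY is asked to prove it: the lead closes the line by deleting this
stub and taking `(hKW : ∀ p …, khare_wintenberger p k)` as the single hypothesis of the final theorem
(`proof.conditional` on KW — the minimum possible for this crux, triage r1-2/3).  Size: named fact
(XL in print; 0 lines owed here). [cite: KhareWintenberger2009, Thm. 1.2 and Thm. 9.1]
[cite: Kisin2009TwoAdic, Thm. 0.1, Cor. 0.2] -/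
theorem stub_khareWintenberger :
    ∀ (p : ℕ) [Fact p.Prime] (k : Type) [Field k] [TopologicalSpace k] [DiscreteTopology k],
      khare_wintenberger p k := by
  sorry

/-- **Serre's conjecture, weak form with the weight bound, from `khare_wintenberger`** (sorry-free
re-indexing of Stub 1; this is the shape the glue consumes).  For every prime `p`, every
algebraically closed discrete field `k` of characteristic `p` and every continuous, odd, irreducible
`σ̄ : Γ_ℚ → GL₂(k)` there are a level `N ≥ 1`, a weight `w ≥ 2`, a newform `f ∈ S_w(Γ₁(N))` and
`ι_f : 𝓞_f →+* k` with `σ̄` attached to `f` along `ι_f` away from `N p`: for every prime `q ∤ N p`,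
`σ̄` is unramified at `q` and `charpoly σ̄(Frob_q) = ι_f(P_q)`, `P_q ∈ 𝓞_f[X]` mapping to the Hecke
polynomial `X² - a_q(f) X + ε_f(q) q^{w-1}` (`IsGaloisRepOfNewform1Int`).  Proof: instantiate the
strong form at a local restriction datum at `p` (`nonempty_localRestrictionAt`) and a residue
embedding (`nonempty_ringHom_residue`), take `N = N(σ̄)`, `w = k(σ̄)`, and use Serre's lower bound
`2 ≤ k(σ̄)` (`ModPGaloisRep.two_le_serreWeightLocal_holds`, Serre 1987, §2.4 Remarque).
[cite: KhareWintenberger2009, Thm. 1.2 and Thm. 9.1] [cite: Serre1987, §2.4 Remarque (2 ≤ k)] -/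
theorem serreModularityTwoLe_of_khareWintenberger
    (hKW : ∀ (p : ℕ) [Fact p.Prime] (k : Type) [Field k] [TopologicalSpace k] [DiscreteTopology k],
      khare_wintenberger p k) :
    ∀ (p : ℕ) [Fact p.Prime] (k : Type) [Field k] [CharP k p] [IsAlgClosed k]
      [TopologicalSpace k] [DiscreteTopology k] (σ : FramedGaloisRep ℚ k 2),
      σ.IsOdd → σ.toGaloisRep.IsIrreducible →
      ∃ (N : ℕ) (_ : NeZero N) (w : ℕ), 2 ≤ w ∧
        ∃ (f : CuspForm (Gamma1 N) (w : ℤ)) (ιf : coeffCharIntegers f →+* k),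
          IsNewform1 f ∧ IsGaloisRepOfNewform1Int f ιf {q | q ∣ N * p} σ := by
  intro p _ k _ _ _ _ _ σ hodd hirr
  obtain ⟨loc⟩ := nonempty_localRestrictionAt (k := k) p σ
  obtain ⟨ι⟩ := nonempty_ringHom_residue (k := k) p loc.F loc.residueFieldCard_eq
  obtain ⟨f, ιf, hf, hρ⟩ := hKW p k σ hirr hodd loc ι
  have h2 := ModPGaloisRep.two_le_serreWeightLocal_holds loc.rep ι
  exact ⟨serreLevel p σ, _, serreWeight p σ loc ι, h2, f, ιf, hf, hρ⟩

/-! ## Stub 2 — lever (A): the residue-adapted embedding of the coefficient ring -/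

/-- **Stub 2 (residue-adapted embedding; pure algebraic number theory, provable now).**  Let `f` be
a newform of level `Γ₁(N)` and weight `w`, `K_f = ℚ(a_n(f), ε_f(n)) ⊆ ℂ` its coefficient field
(`coeffCharField`, a number field: `finiteDimensional_coeffCharField`) and `𝓞_f` its ring of
integers (`coeffCharIntegers`).  For every prime `p`, algebraically closed `k` of characteristic
`p`, ring homomorphisms `red : 𝒪_{ℚ̄_p} →+* k` and `j : 𝓞_f →+* k`, and every `ι : ℚ̄_p ≃+* ℂ`,
there are an embedding `τ : K_f →+* ℂ` and a ring homomorphism `θ : 𝓞_f →+* 𝒪_{ℚ̄_p}` with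
`θ = ι⁻¹ ∘ τ` on `𝓞_f` (first clause) and `red ∘ θ = j` (second clause).
Why true: `red` factors through the residue field of `𝒪_{ℚ̄_p}` (Disproof §3
`red_factors_through_residue`); `θ₀ = ι⁻¹|_{K_f}` maps `𝓞_f` into `ℤ̄ ⊆ 𝒪_{ℚ̄_p}`
(`PadicAlgCl.mem_integer_of_norm_le_one` / integrality); `ker j` and `ker (red ∘ θ₀)` are primes
of `𝓞_f` over `p`, conjugate under `Gal(ℚ̄/ℚ)` acting on `ℤ̄ ⊂ ℚ̄_p`
(Mathlib `Algebra.IsInvariant.exists_smul_of_under_eq_of_profinite`, or the tree's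
`DeligneSerre1974.exists_ringHom_padicAlgCl_of_heightOneSpectrum`), and the two induced embeddings
of the finite field `𝓞_f / ker j` into `k` differ by a power of Frobenius, realised in the
decomposition group (`Ideal.Quotient.stabilizerHom_surjective_of_profinite`); composing gives
`e : K_f → ℚ̄ ⊂ ℚ̄_p` with `red ∘ e = j` on `𝓞_f`, and `τ := ι ∘ e`, `θ := e|_{𝓞_f}`.  Degenerate
case `K_f = ℚ`: `τ` = inclusion.  Non-vacuity: 23a, `K_f = ℚ(√5)`, `p = 3` inert — the two maps
`𝓞_f → 𝔽₉` differ on `a₂` (triage r1-2/3).  Size M (≈ 200 lines).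
[cite: NeukirchANT1999, Ch. I (9.1) and Ch. II (8.1)–(8.2)] [cite: DiamondShurman2005, Thm. 6.5.1] -/
theorem stub_residueAdaptedEmbedding :
    ∀ (p : ℕ) [Fact p.Prime] (k : Type) [Field k] [CharP k p] [IsAlgClosed k]
      (red : Valued.integer (PadicAlgCl p) →+* k) (ι : PadicAlgCl p ≃+* ℂ)
      (N : ℕ) [NeZero N] (w : ℤ) (f : CuspForm (Gamma1 N) w), IsNewform1 f →
      ∀ (j : coeffCharIntegers f →+* k),
        ∃ (τ : coeffCharField f →+* ℂ) (θ : coeffCharIntegers f →+* Valued.integer (PadicAlgCl p)),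
          (∀ x : coeffCharIntegers f,
              ((θ x : Valued.integer (PadicAlgCl p)) : PadicAlgCl p) =
                ι.symm (τ (algebraMap (coeffCharIntegers f) (coeffCharField f) x))) ∧
          ∀ x : coeffCharIntegers f, red (θ x) = j x := by
  sorry

/-! ## Stub 3 — lever (A): Galois-conjugate newforms -/

/-- **Stub 3 (conjugate eigenpackets are newform eigenpackets; classical, provable now).**  For a
newform `f ∈ S_w(Γ₁(N))` and a ring embedding `τ : K_f →+* ℂ` of its coefficient field there is a
newform `g ∈ S_w(Γ₁(M))` of the same weight and some level `M ≥ 1` whose Hecke polynomials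
`X² - a_q(g) X + ε_g(q) q^{w-1}` at the primes `q ∤ N M` are the `τ`-conjugates
`X² - τ(a_q(f)) X + τ(ε_f(q)) q^{w-1}` of those of `f` (in truth `M = N` and `g = f^τ`,
Diamond–Shurman Thm. 6.5.4; the weaker `∃ M` is all the line needs).  Why true / route to a proof in
the tree: `S_w(Γ₁(N))` is spanned by forms with integral `q`-expansions
(`DeligneSerre1974_span_integralLattice1_holds`, PROVED), `T_q` and `⟨d⟩` preserve that lattice
(`heckeT_mem_integralLattice1`, `diamondOp_mem_integralLattice1`), so conjugating `q`-expansions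
coefficientwise by any extension of `τ` carries the eigenvector `f` to an eigenvector with the
conjugate eigenpacket (relations among a spanning set are cut out by integer linear equations —
phrase it on `q`-expansions, triage r1-3), which is the eigenpacket of a newform of some level
`M ∣ N` by `exists_isNewform1_of_eigenpacket` (PROVED).  Fallback engine: the named fact
`Clozel1990_regularAlgebraic` (ii) (card `clozel-conjugation-alignment`).  Size M–L (≈ 300–500 lines).
[cite: DiamondShurman2005, Thm. 6.5.4 and Thm. 5.8.2] [cite: DeligneSerreASENS1974, Prop. 2.7] -/
theorem stub_conjugateNewform :
    ∀ (N : ℕ) [NeZero N] (w : ℤ) (f : CuspForm (Gamma1 N) w), IsNewform1 f →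
      ∀ τ : coeffCharField f →+* ℂ,
        ∃ (M : ℕ) (_ : NeZero M) (g : CuspForm (Gamma1 M) w), IsNewform1 g ∧
          ∀ q : ℕ, q.Prime → ¬ q ∣ N * M →
            (heckePolynomial g q).map (algebraMap (coeffCharField g) ℂ) =
              (heckePolynomial f q).map τ := by
  sorry

/-! ## Stub 4 — lever (B), analytic input: the lowering operator kills the adelic lift -/

/-- **Stub 4 (lowering kills the lift; smoothness in the archimedean variable; M).**  For every
cusp form `f ∈ S_w(Γ₁(N))` (any weight, no eigen-assumption) the adelic lift
`φ_f = adelicLiftFunA N w f` on `GL₂(𝔸_ℚ)` is smooth in the archimedean variable of the automorphy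
datum `AutomorphyDatum.gl 2 ℚ hcpt` (`X ↦ φ_f(g · exp X)` is `C^∞` on `𝔤 = 𝔤𝔩₂(ℚ_∞)`) and is
annihilated by the lowering operator `X = h - i(E₁₂ + E₂₁)` along `ι_𝔸 : GL₂(ℝ) → GL₂(𝔸_ℚ)`
(`GL2Real.lowerFun Rat.iotaA`).  Why true / route: at every adelic point `a`,
`φ_f(a · ι_𝔸(x)) = archLift w f (h₀ x)` for `x ∈ GL₂(ℝ)⁺` (`exists_archSlice_adelicLiftFun`); the
one-parameter subgroups of the datum are those of `ι_𝔸` (`Rat.mul_ofArch_expMem_lieOfReal`,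
`Rat.lieDeriv_ofArch_lieOfReal_eq`); `archLift w f g = f(g·i) j(g,i)^{-w} (det g)^{w/2}` is real-smooth
on `GL₂(ℝ)⁺` because `f` is holomorphic on `ℍ` (Mathlib `UpperHalfPlane.mdifferentiable` ⇒ `C^∞`) and
the Möbius action, `j`, `det` are smooth; and for a smooth `F` of weight `w`, `(X F)(g) = 0 ⟺` the
descent `f_F` is complex-differentiable (`GL2Real.mdifferentiableAt_archDescent_iff_lowering`,
`lowering_eq_of_hasArchWeight`, `archDescent_archLift`, `hasArchWeight_archLift`, all PROVED), i.e.
the Cauchy–Riemann equation of `f` (Bump 1997, p. 274, (2.13); Gelbart 1975, Prop. 3.1 (iv)–(v)).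
This is verbatim the registered `stub_loweringKillsLift` of the sibling line
`lowest-weight-casimir-dictionary` (triage r1 ×3).  Size M (~300 lines).
[cite: Bump1997, §3.2 (2.13) p. 274] [cite: Gelbart1975, Prop. 3.1 (iv)–(v), p. 28] -/
theorem stub_loweringKillsLift :
    ∀ (N : ℕ) [NeZero N] (w : ℤ) (f : CuspForm (Gamma1 N) w)
      (hcpt : isCompact_glFiniteIntegralLevel 2 ℚ),
      IsArchSmooth (AutomorphyDatum.gl 2 ℚ hcpt).ofArch (adelicLiftFunA N w ⇑f) ∧
        GL2Real.lowerFun Rat.iotaA (adelicLiftFunA N w ⇑f) = 0 := by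
  sorry

/-! ## Stub 5 — lever (B), analytic half: the adelic lift of a cusp form is a cusp form on `GL₂(𝔸_ℚ)` -/

/-- **Stub 5 (`φ_f ∈ 𝒜₀(GL₂)` from Stub 4; classical analysis, L).**  For every cusp form
`f ∈ S_w(Γ₁(N))`, `w ≥ 2`, and every compactness witness `hcpt`: IF the adelic lift
`φ_f = adelicLiftFunA N w f : GL₂(𝔸_ℚ) → ℂ` is smooth in the archimedean variable and killed by the
lowering operator along `ι_𝔸` (the two conclusions of Stub 4, taken as hypotheses), THEN `φ_f` is a
CUSP FORM in the Borel–Jacquet sense, `IsCuspFormGL 2 ℚ hcpt` (`= IsAutomorphicForm ∧ CuspConditionGL … 1`,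
`isCuspFormGL_two_iff`).  The six clauses of `IsAutomorphicForm` and the cusp condition, with their
in-tree bricks: (a) left `GL₂(ℚ)`-invariance `adelicLiftFun_ofGlobal_mul`; (a') level
`adelicLiftFunA_mem_fixedPoints_principalCongruenceLevel` + `principalCongruenceLevel_mem_finiteLevelsGL_holds`;
(b) `IsArchSmooth` = hypothesis; (b') `K_∞`-finiteness: `φ_f` has `SO(2)`-weight `w` along `ι_𝔸`
(`isWeightVec_adelicLiftFunA`), its `r(ε)`-translate weight `-w` (`IsWeightVec.archTranslate_epsK`), and
`K_∞ = O(2) = SO(2) ⊔ ε SO(2)` (`maximalCompact_archGroupGL_eq`, `Rat.realToMixedGL_mem_maximalCompact`), so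
the `K_∞`-translates span `≤ 2` dimensions; (c) `Z(𝔤)`-finiteness: `Rat.isZFinite_of_casimir_of_zed`
with `s₁ = (w-1)/2`, `s₂ = (1-w)/2`, the Casimir eigen-equation `∑ E_{ab}E_{ba} φ_f = ((w-1)²/2 - ½) φ_f`
being FIRST ORDER given `X φ_f = 0`: `GL2Real.raiseFun_lowerFun` (`X̄X = 2Ω + W² - 2iW`) with
`W φ_f = iw φ_f` (`lieDeriv_rotGen_adelicLiftFunA`), `Z φ_f = 0` (`lieDeriv_one_adelicLiftFunA`) and
`GL2Real.casimirFun_add_half_zz` (`C = Ω + ½Z²`); (d) moderate growth from boundedness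
(`exists_bound_adelicLiftFun`); cusp condition: `constantTermVanishes_adelicLift` through
`AutomorphicRepsGL.cuspConditionGL_invQuot_iff_holds` (`invQuot (adelicLift N w f) = φ_f`).
Gelbart 1975, Prop. 3.1 (i)–(vii); Bump 1997, §3.6, Thm. 3.6.1; Borel–Jacquet 1979, 4.2 and 4.4.
Size L (≈ 600–900 lines, possibly two files).
[cite: Gelbart1975, Prop. 3.1, p. 28] [cite: Bump1997, §3.6, Thm. 3.6.1] [cite: BorelJacquet1979, 4.2 and 4.4] -/
theorem stub_adelicLiftIsCuspForm :
    ∀ (N : ℕ) [NeZero N] (w : ℤ), 2 ≤ w → ∀ (f : CuspForm (Gamma1 N) w)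
      (hcpt : isCompact_glFiniteIntegralLevel 2 ℚ),
      IsArchSmooth (AutomorphyDatum.gl 2 ℚ hcpt).ofArch (adelicLiftFunA N w ⇑f) →
      GL2Real.lowerFun Rat.iotaA (adelicLiftFunA N w ⇑f) = 0 →
      IsCuspFormGL 2 ℚ hcpt (adelicLiftFunA N w ⇑f) := by
  sorry

/-! ## Stub 6 — lever (B), the dictionary proper, archimedean half: the Harish-Chandra parameter -/

/-- **Stub 6 (archimedean / Harish-Chandra parameter of the datum generated by `φ_f`; HARDEST, held
by the lead).**  Let `f ∈ S_w(Γ₁(N))` be ANY cusp form (any weight, eigenform or not) whose adelic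
lift `φ_f = adelicLiftFunA N w f` is killed by the lowering operator along `ι_𝔸` (Stub 4) and lies in
`𝒜₀` (Stub 5), non-zero, and let `π = CuspidalAutomorphicRepData.ofCuspForm hφ hφ0` be the cuspidal
datum it GENERATES (`W` = stable closure of `φ_f` in `𝒜₀`, `φ_f ∈ W ∖ W'`; Langlands 1979, proof of
Prop. 2).  Then `π` has archimedean parameter `{(w-1)/2, (1-w)/2}` (the infinitesimal character of
the weight-`w` discrete series).  Route: `φ_f` is arch-smooth (`automorphicForms_le_archSmooth`),
`W φ_f = iw φ_f`, `Z φ_f = 0` (`lieDeriv_rotGen_adelicLiftFunA`, `lieDeriv_one_adelicLiftFunA`) and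
`X φ_f = 0` give `C φ_f = ((w-1)²/2 - ½) φ_f` (`GL2Real.raiseFun_lowerFun`, `casimirFun_add_half_zz`),
hence a `Z(𝔤)`-character `θ` on the FUNCTION `φ_f` (`Rat.hasZCharacter_of_casimir_of_zed`); the
subspace `S_θ = {ψ ∈ 𝒜₀ : z ψ = θ(z) ψ ∀ z ∈ Z(𝔤)}` is STABLE (central words commute with Lie
derivatives, with `K_∞`- and `GL₂(𝔸_f)`-translations: `applyFree_archTranslate_of_isCentralWord`,
`commute_ofArch`) and contains `φ_f`, hence `W ≤ S_θ` (`W_ofCuspForm_le`: infinitesimal character BY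
MINIMALITY/CYCLICITY — no Schur, no admissibility); so `π.HasInfinitesimalCharacter θ` for the Lie
action `exists_hasLieAction_holds`, and `GL2Casimir.hasHCParameter_of_lift_casimir_of_lift_zed` (no
regularity hypothesis) on the non-zero class `[φ_f]` reads the parameter `{(w-1)/2, (1-w)/2}` off the
two scalars at the unique (real) place of `ℚ` (`Rat.exists_lieEquiv_lieOfReal`, template: the
weight-one bridge `GL2AdelicWeightVectors` read backwards).  Size L (≈ 500 lines).
[cite: LanglandsCorvallis1979Notion, proof of Prop. 2] [cite: Bump1997, §2.5, Thm. 2.5.4] [cite: Knapp2002, Thm. 5.44 with Prop. 5.32] -/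
theorem stub_archParameterOfGeneratedDatum :
    ∀ (N : ℕ) [NeZero N] (w : ℤ) (f : CuspForm (Gamma1 N) w)
      (hcpt : isCompact_glFiniteIntegralLevel 2 ℚ),
      GL2Real.lowerFun Rat.iotaA (adelicLiftFunA N w ⇑f) = 0 →
      ∀ (hφ : adelicLiftFunA N w ⇑f ∈ cuspFormsGL 2 ℚ hcpt) (hφ0 : adelicLiftFunA N w ⇑f ≠ 0),
      (CuspidalAutomorphicRepData.ofCuspForm hφ hφ0).1.HasArchParameter
        (fun _ => ({((w : ℂ) - 1) / 2, (1 - (w : ℂ)) / 2} : Multiset ℂ)) := by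
  sorry

/-! ## Stub 7 — lever (B), the dictionary proper, finite half + THE DOUBLE TWIST -/

/-- **Stub 7 (the L-normalised dictionary: unitary Satake pairs of a datum containing `φ_f`, then the
double twist `⊗ (ofDirichlet ε)⁻¹∘det ⊗ |det|^{(k-1)/2}`; M/L).**  Let `f ∈ S_k(Γ₁(N))`, `k ≥ 2`, be a
NEWFORM and `π = W / W'` a cuspidal datum on `GL₂(𝔸_ℚ)` with `φ_f ∈ W ∖ W'` and archimedean parameter
`{(k-1)/2, (1-k)/2}`.  Then there is an L-ALGEBRAIC cuspidal datum `π₂` whose Satake parameter at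
almost every finite place `v = q` is `{β₁⁻¹, β₂⁻¹}`, `β_{1,2}` the complex roots of the Hecke polynomial
`H_q(f) = X² - a_q X + ε(q) q^{k-1}` (`ModularForms.heckePolynomial f q` mapped to `ℂ`).
Route: (i) at `v ∤ N`, `π` has the unitary Satake pair `{α₁, α₂}`, `α₁ + α₂ = a_q (√q)^{1-k}`,
`α₁α₂ = ε(q)`: `φ_f` is `K(N)`-fixed (`adelicLiftFunA_mem_fixedPoints_principalCongruenceLevel`) and the
PROVED operator identities `[K(N) diag(ϖ,1) K(N)] φ_f = (√q)^{2-k} φ_{T_q f}`,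
`[K(N) diag(ϖ,ϖ) K(N)] φ_f = φ_{⟨q⟩ f}` (`heckeOperator_principalCongruenceLevel_adelicLiftFunA_one/two`,
uniformizer `Rat.localUniformizer v`) combine with `T_q f = a_q f`, `⟨q⟩ f = ε(q) f`
(`IsNewform1.heckeEigenvalue_eq_coeff_holds`, `IsNewform1.mem_nebentypusSubspace_nebentypus_holds`;
linearity of `f ↦ φ_f`), `T_{v,0} = 1` (`heckeOperator_apply_of_mem_center`) and
`AutomorphicRepData.hasSatakeParamAt_of_eigenvector` (`φ_f ∈ W ∖ W'`), `{α₁, α₂}` the roots of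
`X² - a_q(√q)^{1-k}X + ε(q)` (`exists_pair_add_eq_mul_eq`; template: the weight-one
`AutomorphicRepData.hasSatakeParamAt_of_adelicLiftFunA_mem`); (ii) `π₁ := π.twist (ofDirichlet ε⁻¹)`
(`CuspidalAutomorphicRepData.twist`, `eventually_hasSatakeParamAt_twist` /
`HasSatakeParamAt.twist_of_isUnramifiedAt`, `HeckeCharacter.valueAtUniformizer_ofDirichlet`) has pair
`ε(q)⁻¹{α₁, α₂} = {α₂⁻¹, α₁⁻¹}` (since `α₁α₂ = ε(q)`; no Ramanujan, no contragredient) and the SAME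
archimedean parameter (`HasArchParameter.twist`); (iii) `π₂ := π₁ ⊗ |det|^{(k-1)/2}`
(`CuspidalAutomorphicRepData.exists_twist_hasInfinityType`, `HasSatakeParamAt.of_map_mulChar_detTwist_of_cpow`)
has Satake `q^{-(k-1)/2}{α₂⁻¹, α₁⁻¹} = {β_j⁻¹}` and infinity type `{(k-1, 0), (0, k-1)}`
= `weightInfinityTypeGL2 ℚ k` — L-algebraic for every `k` (`isLAlgebraic_weightInfinityTypeGL2`);
(iv) the exceptional `v` are finitely many.  Pin (triage r1-3, kernel-checked): `X₀(11)`, `q = 2`,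
`p = 3`: `X² + 2X + 2 ≡ X² - X - 1 (mod 3)`.  This is verbatim the registered `stub_dictionaryL` of the
sibling line `lowest-weight-casimir-dictionary`.  Size M/L (≈ 500 lines; Satake part and twist part
may land as two files).
[cite: Gelbart1975, §3 Lemma 3.7 and Thm. 5.19] [cite: Bump1997, Thm. 3.6.1, pp. 340–342]
[cite: BuzzardGeeLMS2014, Def. 3.1.1 and §3.4] [cite: ArthurClozelAMS120, Ch. 3, proof of Thm. 3.1 (p. 172)] -/
theorem stub_dictionaryL :
    ∀ (N : ℕ) [NeZero N] (k : ℤ), 2 ≤ k → ∀ (f : CuspForm (Gamma1 N) k), IsNewform1 f →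
      ∀ (hcpt : isCompact_glFiniteIntegralLevel 2 ℚ) (π : CuspidalAutomorphicRepData 2 ℚ hcpt),
        adelicLiftFunA N k ⇑f ∈ π.1.W → adelicLiftFunA N k ⇑f ∉ π.1.W' →
        π.1.HasArchParameter (fun _ => ({((k : ℂ) - 1) / 2, (1 - (k : ℂ)) / 2} : Multiset ℂ)) →
          ∃ π₂ : CuspidalAutomorphicRepData 2 ℚ hcpt, π₂.1.IsLAlgebraic ∧
            ∀ᶠ v : HeightOneSpectrum (𝓞 ℚ) in Filter.cofinite,
              π₂.1.HasSatakeParamAt v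
                (((heckePolynomial f ((Rat.HeightOneSpectrum.primesEquiv v : Nat.Primes) : ℕ)).map
                    (algebraMap (coeffCharField f) ℂ)).roots.map (·⁻¹)) := by
  sorry

/-! ## Glue lemmas (sorry-free) -/

/-- **The L-normalised Frobenius polynomial of the inverted roots is the polynomial itself.**  For
`ι : ℚ̄_p ≃+* ℂ` and a monic `P ∈ ℂ[X]` (which splits), `arithFrobPolyOfSatake ι q 1 (P.roots.map (·⁻¹))
= ∏_{β} (X - ι⁻¹((β⁻¹)⁻¹)) = ∏_{β} (X - ι⁻¹ β) = P.map ι⁻¹` — the `m = 1` twin of the tree's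
`arithFrobPolyOfSatake_heckeRoots` (`m = 2`); no non-vanishing of the roots is needed
(`(β⁻¹)⁻¹ = β` also for `β = 0`).  Buzzard–Gee's L-normalisation. [cite: BuzzardGeeLMS2014, §2.1] -/
theorem arithFrobPolyOfSatake_one_rootsInv {p : ℕ} [Fact p.Prime] (ι : PadicAlgCl p ≃+* ℂ)
    (q : ℕ) {P : ℂ[X]} (hP : P.Monic) :
    arithFrobPolyOfSatake ι q 1 (P.roots.map (·⁻¹)) = P.map (ι.symm : ℂ →+* PadicAlgCl p) := by
  rw [arithFrobPolyOfSatake_one, Multiset.map_map]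
  have hcard : Multiset.card P.roots = P.natDegree :=
    Polynomial.splits_iff_card_roots.mp (IsAlgClosed.splits P)
  trans (P.roots.map fun β ↦ (X - C β).map (ι.symm : ℂ →+* PadicAlgCl p)).prod
  · congr 1
    refine Multiset.map_congr rfl fun β _ ↦ ?_
    simp only [Function.comp_apply, inv_inv, Polynomial.map_sub, Polynomial.map_X, Polynomial.map_C]
    rfl
  · conv_rhs => rw [← Polynomial.prod_multiset_X_sub_C_of_monic_of_roots_card_eq hP hcard]
    rw [Polynomial.map_multiset_prod, Multiset.map_map]
    rfl

/-- The finite places of `ℚ` whose prime divides `n ≠ 0` form a finite set (`v ↦ p_v` is injective,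
`Rat.HeightOneSpectrum.primesEquiv`). [folklore] -/
theorem finite_setOf_primesEquiv_dvd {n : ℕ} (hn : n ≠ 0) :
    {v : HeightOneSpectrum (𝓞 ℚ) | ((Rat.HeightOneSpectrum.primesEquiv v : Nat.Primes) : ℕ) ∣ n}.Finite := by
  refine ((Set.finite_Iic n).preimage
    (f := fun v : HeightOneSpectrum (𝓞 ℚ) ↦ ((Rat.HeightOneSpectrum.primesEquiv v : Nat.Primes) : ℕ))
    ?_).subset ?_
  · intro v _ v' _ hvv'
    exact Rat.HeightOneSpectrum.primesEquiv.injective (Subtype.ext hvv')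
  · intro v hv
    exact Nat.le_of_dvd (Nat.pos_of_ne_zero hn) hv

/-- For `n ≠ 0`, almost every finite place `v` of `ℚ` has `p_v ∤ n`. [folklore] -/
theorem eventually_not_dvd {n : ℕ} (hn : n ≠ 0) :
    ∀ᶠ v : HeightOneSpectrum (𝓞 ℚ) in Filter.cofinite,
      ¬ ((Rat.HeightOneSpectrum.primesEquiv v : Nat.Primes) : ℕ) ∣ n := by
  rw [Filter.eventually_cofinite]
  simpa only [not_not] using finite_setOf_primesEquiv_dvd hn

/-- A newform is non-zero (`a₁ = 1`), hence so is its adelic lift (`exists_adelicLiftFun_ne_zero`: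
`|φ_f((y x; 0 1), 1)| = |f(x+iy)| y^{w/2}`). [cite: Gelbart1975, (3.4)] -/
theorem adelicLiftFunA_ne_zero_of_isNewform1 {M : ℕ} [NeZero M] {w : ℤ} {g : CuspForm (Gamma1 M) w}
    (hg : IsNewform1 g) : adelicLiftFunA M w ⇑g ≠ 0 := by
  have hg0 : g ≠ 0 := by
    rintro rfl
    have h1 := hg.2.2.2
    unfold IsNormalized at h1
    rw [CuspForm.coe_zero, UpperHalfPlane.qExpansion_zero, map_zero] at h1
    exact zero_ne_one h1
  have hex : ∃ τ₀ : UpperHalfPlane, g τ₀ ≠ 0 := by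
    by_contra h
    exact hg0 (DFunLike.ext g 0 fun τ₀ => by rw [not_exists.mp h τ₀ |> not_not.mp]; rfl)
  obtain ⟨x, -, hx⟩ := exists_adelicLiftFun_ne_zero (N := M) (k := w) g hex
  intro h0
  apply hx
  have h1 : adelicLiftFunA M w ⇑g (Rat.ofRealGL 2 x) = 0 := by rw [h0]; rfl
  simpa using h1

/-! ## The composition: the seven stubs imply the crux BY NAME -/

/-- **`SerreKWAutomorphicGL2` from the seven stubs** (kernel-checked glue, no `sorry` outside the
stubs).  Fix `p, k, red, σ̄` odd irreducible, `hcpt₂`, `ι`.  Stub 1 (KW): a newform `f` of weight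
`w ≥ 2`, level `N`, and `ι_f : 𝓞_f → k` with `charpoly σ̄(Frob_q) = ι_f(P_q)`, `P_q ↦ H_q(f)`, for
`q ∤ Np`.  Stub 2: `τ : K_f → ℂ`, `θ : 𝓞_f → 𝒪_{ℚ̄_p}` with `θ = ι⁻¹τ` on `𝓞_f`, `red ∘ θ = ι_f`.
Stub 3: a newform `g` of weight `w`, level `M`, with `H_q(g) = τ(H_q(f))` in `ℂ[X]` for `q ∤ NM`.
Stubs 4, 5, 6, 7 applied to `g`: an L-algebraic cuspidal `π₂` on `GL₂(𝔸_ℚ)` with Satake multiset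
`H_q(g).roots⁻¹` a.e.  At every `v` outside the three finite exceptional sets put
`P := θ(P_q) ∈ 𝒪_{ℚ̄_p}[X]`, `Pb := ι_f(P_q)`: then `P ↦ ι⁻¹τ(P_q ↦ K_f) = ι⁻¹(τ H_q(f)) = ι⁻¹ H_q(g)
= arithFrobPolyOfSatake ι q 1 (H_q(g).roots⁻¹)` (`arithFrobPolyOfSatake_one_rootsInv`) and
`P mod 𝔪 = red(θ P_q) = ι_f(P_q) = Pb = charpoly σ̄(Frob_v)`, with `σ̄` unramified at `v`. -/
theorem SerreKWAutomorphicGL2_of :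
    Summit.Langlands.Langlands.Theses.PhantomRMYoshida.SerreKWAutomorphicGL2 := by
  intro p _ k _ _ _ _ _ red σ hodd hirr hcpt₂ ι
  -- (A) Galois side: KW (the named fact, Stub 1, through its weak form), alignment, conjugation
  obtain ⟨N, _instN, w, hw, f, ιf, hf, hKW⟩ :=
    serreModularityTwoLe_of_khareWintenberger stub_khareWintenberger p k σ hodd hirr
  obtain ⟨τ, θ, hθ, hred⟩ := stub_residueAdaptedEmbedding p k red ι N _ f hf ιf
  obtain ⟨M, _instM, g, hg, hconj⟩ := stub_conjugateNewform N _ f hf τ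
  -- (B) automorphic side for the conjugate newform `g`
  have hw' : (2 : ℤ) ≤ ((w : ℕ) : ℤ) := by exact_mod_cast hw
  obtain ⟨hsm, hlow⟩ := stub_loweringKillsLift M _ g hcpt₂
  have hφ : adelicLiftFunA M (w : ℤ) ⇑g ∈ cuspFormsGL 2 ℚ hcpt₂ :=
    (stub_adelicLiftIsCuspForm M _ hw' g hcpt₂ hsm hlow).mem_cuspFormsGL
  have hφ0 : adelicLiftFunA M (w : ℤ) ⇑g ≠ 0 := adelicLiftFunA_ne_zero_of_isNewform1 hg
  have harch := stub_archParameterOfGeneratedDatum M _ g hcpt₂ hlow hφ hφ0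
  obtain ⟨π₂, hL, hsat₂⟩ :=
    stub_dictionaryL M _ hw' g hg hcpt₂ (CuspidalAutomorphicRepData.ofCuspForm hφ hφ0)
      (CuspidalAutomorphicRepData.mem_W_ofCuspForm hφ hφ0)
      (CuspidalAutomorphicRepData.not_mem_W'_ofCuspForm hφ hφ0) harch
  refine ⟨π₂, hL, ?_⟩
  -- the three finite exceptional sets
  have hp : p.Prime := Fact.out
  have hgoodNp := eventually_not_dvd (n := N * p) (mul_ne_zero (NeZero.ne N) hp.ne_zero)
  have hgoodNM := eventually_not_dvd (n := N * M) (mul_ne_zero (NeZero.ne N) (NeZero.ne M))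
  filter_upwards [hsat₂, hgoodNp, hgoodNM] with v hv hvNp hvNM
  -- KW's local clause at `v`
  obtain ⟨hunr, Pint, hPint, hFrob⟩ := hKW v hvNp
  refine ⟨_, Pint.map θ, Pint.map ιf, hv, ?_, hunr, hFrob, ?_⟩
  · -- integrality transport + the root-form identity
    have hmonic : ((heckePolynomial g ((Rat.HeightOneSpectrum.primesEquiv v : Nat.Primes) : ℕ)).map
        (algebraMap (coeffCharField g) ℂ)).Monic :=
      (monic_heckePolynomial g _).map _
    have hθ' : (Valued.integer (PadicAlgCl p)).subtype.comp θ =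
        ((ι.symm : ℂ →+* PadicAlgCl p).comp τ).comp
          (algebraMap (coeffCharIntegers f) (coeffCharField f)) :=
      RingHom.ext fun x => hθ x
    rw [arithFrobPolyOfSatake_one_rootsInv ι _ hmonic,
      hconj _ (Rat.HeightOneSpectrum.primesEquiv v).2 hvNM]
    simp only [Polynomial.map_map]
    rw [← hPint, Polynomial.map_map, hθ']
  · rw [Polynomial.map_map]
    exact congrArg (fun F : coeffCharIntegers f →+* k => Pint.map F) (RingHom.ext hred)

end Summit.Langlands.Langlands.Cruxes.SerreKWAutomorphicGL2.AdelicNewformDatumDoubleTwist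

end
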